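import Summits.QuantumFields.YangMills.Theorems.BalabanUVNodesN19TiltedPriceGauges
import Summits.QuantumFields.YangMills.Theorems.BalabanUVNodesN19MGFJoinConverse

/-!
# YM-DAG node N19 (= NE7 proper) — THE TILTED PRICE, module 2∕3: close cgf's on a window pay the TILTED MEANS Bernstein's
# `ε·log ε⁻¹∕(log log ε⁻¹·√(l₀² − s²))` at an interior source `s`, and Markov's `ε·log² ε⁻¹∕(l₀·log² log ε⁻¹)` up to the edge `|s| = l₀`

Cell `pub-ymgap`, HUMAN RULING D-0062 (Track A), R141 (C) wider-strategy seat `pub-ymgap-dag-n19-e` (strategy s3 = ALTERNATIVE CURRENCY), generation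
g15, module 2 of 3 (siblings: `…N19TiltedPriceGauges` — the complex-variable engine; `…N19TiltedPriceTwoSided` — the lower bound at the edge).
Route `Summits/QuantumFields/YangMills/Theses/BalabanUVNodes.lean` rev 21, cluster item K3⁵ «SpineGivenEndpointR13SepCoP» (stmt-QuantumFields-20296);
filed `--supports` that item `--as helper` (it proves no registered stub).  COUNT-NEUTRAL: elementary probability over Mathlib (`Measure.tilted`,
`complexMGF`) + the seat's modules BY NAME — `…N19TiltedPriceGauges` (`norm_deriv_le_linlog_of_segment`, `norm_deriv_le_sqlog_of_segment_end∕start`),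
p480837 `…N19ExpectationCurrencyTwoConstants` (`norm_complexMGF_sub_complexMGF_le`, `abs_mgf_sub_mgf_le_of_cgf_close`), p497552 `…N19MGFJoinConverse`
(`mgf_tilted_mul`; its `abs_tiltedMean_sub_le_linlog_of_cgf_close` is the theorem sharpened here), `DressedMGFForm.tiltedMean`; NOT a discharge claim.

WHAT IT SAYS.  p497552 priced the tilted means — `tiltedMean F ν s = ∫F d(e^{sF}ν∕∫e^{sF}dν)`, the derivative of the cgf — of two `[−B, B]`-bounded
observables whose cgf's are `ε`-close MODULO A CONSTANT on the window `|u| ≤ l₀` (N19's matching-mod-constants shape, one class) by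
`8e^{1+(l₀−l₁)B}·ε·(1 + log⁺(2ε)⁻¹)∕(l₀ − l₁)` for `|s| ≤ l₁ < l₀`: it tilts at `s` (the tilted cgf is the SHIFTED cgf, the constant cancels) and applies
p480837's centre lemma on the symmetric sub-window `|t| < l₀ − l₁` only.  The sharp shape uses the WHOLE shifted window `[−l₀ − s, l₀ − s] ∋ 0` through
module 1's shifted sine gauge: §2 ★ `abs_integral_sub_integral_le_sharp_of_cgf_close_segment` (two probability spaces, cgf's `ε`-close on a segment
`[a, b] ∋ 0`: `|EY − EX| ≤ 4e^{1+e·lB}·ε·(1 + L)∕(√(−ab)·log(e + L))`, `l = max(−a, b)`, `L = log⁺ε⁻¹` — at `[−l₀, l₀]` it is p516009's ★★ verbatim),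
★ `abs_integral_sub_integral_le_edge_of_cgf_close_left ∕ _right` (closeness on `[a, 0]` resp. `[0, b]` only — `0` an END of the segment:
`|EY − EX| ≤ 32e^{2+(2e−1)lB}·ε·(1 + L)²∕(l·log²(e + L))`, `l` the length; module 1's cosine gauge); §3 under p497552's hypotheses (a.e. form):
★★ `abs_tiltedMean_sub_le_sharp_of_cgf_close` — for every `|s| < l₀`,
`|tiltedMean F′ ν′ s − tiltedMean F ν s| ≤ 8e^{1+e(l₀+|s|)B}·ε·(1 + L₂)∕(√(l₀² − s²)·log(e + L₂))`, `L₂ = log⁺(2ε)⁻¹` (BERNSTEIN: `≍ ε·n∕√(l₀² − s²)` with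
`n = L∕log L`; at `s = 0` it is p516009's sharp price, and for `|s| ≤ l₁ < l₀` it beats p497552 by the factor `log log ε⁻¹·(l₀ − l₁)∕√(l₀² − l₁²)`), and
★★ `abs_tiltedMean_sub_le_edge_of_cgf_close` — for every `|s| ≤ l₀`, the edge included,
`|tiltedMean F′ ν′ s − tiltedMean F ν s| ≤ 64e^{2+(2e−1)(l₀+|s|)B}·ε·(1 + L₂)²∕(l₀·log²(e + L₂))` (MARKOV: `≍ ε·n²∕l₀`, uniform on the CLOSED window; the
half-window `[−l₀ − s, 0]` or `[0, l₀ − s]` of length `≥ l₀` with `0` at its end).  Module 3 shows the edge order is attained.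

KERNEL-CHECKED (0 `def`, 0 `sorry`): §1 `half_abs_add_add_half_sub_eq_max`, `cgf_tilted_mul_of_ae`, `isProbabilityMeasure_tilted_mul_of_ae` · §2 ★
`abs_integral_sub_integral_le_sharp_of_cgf_close_segment`, ★ `abs_integral_sub_integral_le_edge_of_cgf_close_left`, ★ `…_right` · §3 ★★
`abs_tiltedMean_sub_le_sharp_of_cgf_close`, ★★ `abs_tiltedMean_sub_le_edge_of_cgf_close`.  NOT claimed: optimal constants; an interior lower bound of
Bernstein shape (the grid witnesses' `U_{M−1}` phase is not controlled — only the centre (p517472) and the edge (module 3) are typed two-sided).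

HONEST FRAMING (binding).  Elementary; NO consumer in the DAG today (N14's `TiltedMeanMatching` binder needs SOME `l₁ < l₀`, served by p497552;
value = the sharp shape of the lineage's tilted currency: centre `n` ∕ interior `n∕√(1−x²)` ∕ edge `n²` ∕ outside `T_n(x)`).  Nothing of
[Balaban1987RG1]–[Balaban1989LargeFieldII] or [King1986] is asserted, quoted or instantiated; NE7 ∕ NE7b ∕ NE7c NOT PRINTED, NOT proved; N19 NOT discharged;
Track A count unmoved (typed 28∕28 · discharged 5∕27 · A 5∕28).  One finite `T⁴` programme at fixed `ε`; nothing continuum ∕ `ℝ⁴` ∕ OS ∕ mass-gap ∕ Clay.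
THEOREMS ONLY; standard axioms; no cite tags.
-/

set_option autoImplicit false

noncomputable section

open Set Metric Filter Topology MeasureTheory ProbabilityTheory Complex

namespace Summit.QuantumFields.YangMills.Theorems.BalabanUVNodesN19TiltedPrice

open Literature.MathematicalPhysics.QuantumFieldTheory.Balaban1983to89
open Summit.QuantumFields.YangMills.BalabanUVNodes.N19ExpectationCurrencyTwoConstants
  (norm_complexMGF_sub_complexMGF_le abs_mgf_sub_mgf_le_of_cgf_close)
open Summit.QuantumFields.YangMills.Theorems.BalabanUVNodesN19TiltedPriceGauges
  (norm_deriv_le_linlog_of_segment norm_deriv_le_sqlog_of_segment_end norm_deriv_le_sqlog_of_segment_start)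
open Summit.QuantumFields.BalabanUV.T4Continuum.NE1p.DressedMGFForm (tiltedMean)
open Summit.QuantumFields.YangMills.BalabanUVNodes.N19MGFJoinConverse (mgf_tilted_mul)

/-! ## §1 Two small facts [folklore] -/

/-- `|a+b|∕2 + (b−a)∕2 = max(−a, b)` (centre-modulus plus half-length of a segment is its farthest end). [folklore] -/
theorem half_abs_add_add_half_sub_eq_max (a b : ℝ) : |a + b| / 2 + (b - a) / 2 = max (-a) b := by
  rcases le_or_gt 0 (a + b) with h | h
  · rw [abs_of_nonneg h, max_eq_right (by linarith)]; ring
  · rw [abs_of_neg h, max_eq_left (by linarith)]; ring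

section Tilting

variable {Ω : Type*} {mΩ : MeasurableSpace Ω} {ν : Measure Ω} {F : Ω → ℝ} {B : ℝ} [IsFiniteMeasure ν]

/-- **The cgf of the source-tilted measure is the shifted cgf** (a.e. form of p497552's `cgf_tilted_mul`): `ν ≠ 0` finite, `F` a.e.-measurable with
`|F| ≤ B` a.e. ⇒ `cgf F (ν.tilted (s·F)) t = cgf F ν (s + t) − cgf F ν s`. [folklore] -/
theorem cgf_tilted_mul_of_ae [NeZero ν] (hFm : AEMeasurable F ν) (hF : ∀ᵐ ω ∂ν, |F ω| ≤ B) (s t : ℝ) :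
    cgf F (ν.tilted fun ω => s * F ω) t = cgf F ν (s + t) - cgf F ν s := by
  have hpos : ∀ u, 0 < mgf F ν u := fun u => T4GenFunBounds.mgf_pos_of_abs_le hFm hF u
  simp only [cgf]
  rw [mgf_tilted_mul, Real.log_div (hpos _).ne' (hpos _).ne']

/-- The source-tilted measure is a probability measure (a.e. form). [folklore] -/
theorem isProbabilityMeasure_tilted_mul_of_ae [NeZero ν] (hFm : AEMeasurable F ν) (hF : ∀ᵐ ω ∂ν, |F ω| ≤ B) (s : ℝ) :
    IsProbabilityMeasure (ν.tilted fun ω => s * F ω) :=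
  isProbabilityMeasure_tilted (T4GenFunBounds.integrable_exp_mul_of_bound hFm hF s)

end Tilting

/-! ## §2 Two probability spaces: cgf's close on a segment `[a, b] ∋ 0` — Bernstein inside, Markov at an end [folklore] -/

section MGF

variable {Ω Ω' : Type*} [MeasurableSpace Ω] [MeasurableSpace Ω'] {μ : Measure Ω} {ν : Measure Ω'}
  [IsProbabilityMeasure μ] [IsProbabilityMeasure ν] {X : Ω → ℝ} {Y : Ω' → ℝ} {B : ℝ}

/-- **THE SHARP PRICE ON AN ASYMMETRIC SEGMENT (Bernstein's shape).**  Two probability spaces, observables `|X|, |Y| ≤ B` a.e.; if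
`|cgf_Y(t) − cgf_X(t)| ≤ ε` for every real `a ≤ t ≤ b` with `a < 0 < b` (`0 ≤ ε`), then
`|∫ Y dν − ∫ X dμ| ≤ 4·e^{1+e·lB}·ε·(1 + log⁺ε⁻¹)∕(√(−ab)·log(e + log⁺ε⁻¹))`, `l = max(−a, b)`
— module 1's shifted sine gauge for `f = complexMGF Y ν − complexMGF X μ` (`‖f z‖ ≤ 2e^{B‖z‖}`; `≤ 2εe^{lB}` on the segment; `e^{K} = e + log⁺ε⁻¹`).
At `[−l₀, l₀]` it is p516009's `abs_integral_sub_integral_le_sharp_of_cgf_close`. [folklore] -/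
theorem abs_integral_sub_integral_le_sharp_of_cgf_close_segment (hX : AEMeasurable X μ) (hY : AEMeasurable Y ν)
    (hXB : ∀ᵐ ω ∂μ, |X ω| ≤ B) (hYB : ∀ᵐ ω ∂ν, |Y ω| ≤ B) {ε a b : ℝ} (ha : a < 0) (hb : 0 < b) (hε0 : 0 ≤ ε)
    (hε : ∀ t : ℝ, a ≤ t → t ≤ b → |cgf Y ν t - cgf X μ t| ≤ ε) :
    |∫ ω, Y ω ∂ν - ∫ ω, X ω ∂μ| ≤
      4 * Real.exp (1 + Real.exp 1 * max (-a) b * B) * ε * (1 + Real.posLog ε⁻¹) /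
        (Real.sqrt (-(a * b)) * Real.log (Real.exp 1 + Real.posLog ε⁻¹)) := by
  have hB0 : 0 ≤ B := T4GenFunBounds.nonneg_of_ae_abs_le (IsProbabilityMeasure.ne_zero μ) hXB
  set l := max (-a) b with hl
  have hl0 : 0 < l := hb.trans_le (le_max_right _ _)
  set L := Real.posLog ε⁻¹ with hL
  have hL0 : 0 ≤ L := Real.posLog_nonneg
  have heL : 0 < Real.exp 1 + L := by positivity
  set K := Real.log (Real.exp 1 + L) with hK
  have hK1 : 1 ≤ K := by rw [hK, Real.le_log_iff_exp_le heL]; linarith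
  have hK0 : 0 < K := one_pos.trans_le hK1
  have hexpK : Real.exp K = Real.exp 1 + L := Real.exp_log heL
  have heK1 : 1 ≤ Real.exp K := Real.one_le_exp hK0.le
  set f : ℂ → ℂ := fun z => complexMGF Y ν z - complexMGF X μ z with hf
  have hdY := T4GenFunBounds.differentiable_complexMGF_of_abs_le hY hYB
  have hdX := T4GenFunBounds.differentiable_complexMGF_of_abs_le hX hXB
  have hfd : Differentiable ℂ f := hdY.sub hdX
  -- big-disc bound (exponential type): the gauge's disc has radius `≤ l·e^{K}`
  have hrad : |a + b| / 2 + (b - a) / 2 * Real.exp (K * 1) ≤ l * Real.exp K := by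
    rw [mul_one, hl, ← half_abs_add_add_half_sub_eq_max a b, add_mul]
    have : 0 ≤ |a + b| / 2 := by positivity
    nlinarith
  have hM : ∀ z : ℂ, ‖z‖ ≤ |a + b| / 2 + (b - a) / 2 * Real.exp (K * 1) → ‖f z‖ ≤ 2 * Real.exp (l * Real.exp K * B) :=
    fun z hz => (norm_complexMGF_sub_complexMGF_le hXB hYB z).trans (by gcongr; exact hz.trans hrad)
  -- segment bound
  have hm : ∀ x : ℝ, a ≤ x → x ≤ b → ‖f x‖ ≤ 2 * ε * Real.exp (l * B) := fun x h1 h2 => by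
    show ‖complexMGF Y ν x - complexMGF X μ x‖ ≤ _
    rw [complexMGF_ofReal, complexMGF_ofReal, ← Complex.ofReal_sub, Complex.norm_real, Real.norm_eq_abs]
    have hxl : |x| ≤ l := abs_le.2 ⟨by linarith [le_max_left (-a) b], h2.trans (le_max_right _ _)⟩
    exact (abs_mgf_sub_mgf_le_of_cgf_close hX hY hXB hYB (hε x h1 h2)).trans (by gcongr)
  have key := norm_deriv_le_linlog_of_segment ha hb hK0 one_pos hfd hM hm (by positivity)
  -- the derivative at `0` is the difference of the means
  have hderiv : deriv f 0 = (((∫ ω, Y ω ∂ν) - ∫ ω, X ω ∂μ : ℝ) : ℂ) := by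
    have e1 : deriv f 0 = deriv (complexMGF Y ν) 0 - deriv (complexMGF X μ) 0 := deriv_sub (hdY 0) (hdX 0)
    have eY := T4GenFunBounds.iteratedDeriv_complexMGF_zero_of_abs_le hY hYB 1
    have eX := T4GenFunBounds.iteratedDeriv_complexMGF_zero_of_abs_le hX hXB 1
    rw [iteratedDeriv_one] at eY eX
    rw [e1, eY, eX, Complex.ofReal_sub]
    simp
  rw [hderiv, Complex.norm_real, Real.norm_eq_abs, one_mul] at key
  refine key.trans ?_
  rcases hε0.eq_or_lt with hε00 | hεpos
  · rw [← hε00]; simp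
  -- `1 + log⁺(M/m) ≤ 1 + lB(e^K − 1) + L ≤ e^{(e−1)lB}(1 + L)`
  have hq : 2 * Real.exp (l * Real.exp K * B) / (2 * ε * Real.exp (l * B)) = Real.exp (l * B * (Real.exp K - 1)) * ε⁻¹ := by
    rw [show l * B * (Real.exp K - 1) = l * Real.exp K * B - l * B by ring, Real.exp_sub]
    field_simp
  have hb0 : 0 ≤ l * B := mul_nonneg hl0.le hB0
  have hc0 : 0 ≤ l * B * (Real.exp K - 1) := mul_nonneg hb0 (by linarith)
  have hlog : Real.posLog (2 * Real.exp (l * Real.exp K * B) / (2 * ε * Real.exp (l * B))) ≤ l * B * (Real.exp K - 1) + L := by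
    rw [hq]
    refine Real.posLog_mul.trans (add_le_add (le_of_eq ?_) le_rfl)
    rw [Real.posLog_eq_log (by rw [abs_of_pos (Real.exp_pos _)]; exact Real.one_le_exp hc0), Real.log_exp]
  have hnum : 1 + (l * B * (Real.exp K - 1) + L) ≤ Real.exp ((Real.exp 1 - 1) * (l * B)) * (1 + L) := by
    rw [hexpK]
    have h1 : 1 + (l * B * (Real.exp 1 + L - 1) + L) ≤ (1 + (Real.exp 1 - 1) * (l * B)) * (1 + L) := by
      nlinarith [mul_nonneg hb0 hL0, Real.add_one_le_exp (1 : ℝ)]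
    refine h1.trans (mul_le_mul_of_nonneg_right ?_ (by positivity))
    linarith [Real.add_one_le_exp ((Real.exp 1 - 1) * (l * B))]
  calc 2 * Real.exp 1 * (2 * ε * Real.exp (l * B)) *
        (1 + Real.posLog (2 * Real.exp (l * Real.exp K * B) / (2 * ε * Real.exp (l * B)))) / (K * Real.sqrt (-(a * b)))
      ≤ 2 * Real.exp 1 * (2 * ε * Real.exp (l * B)) * (Real.exp ((Real.exp 1 - 1) * (l * B)) * (1 + L)) /
          (K * Real.sqrt (-(a * b))) := by
        gcongr 2 * Real.exp 1 * (2 * ε * Real.exp (l * B)) * ?_ / _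
        linarith [hlog, hnum]
    _ = 4 * Real.exp (1 + Real.exp 1 * l * B) * ε * (1 + L) / (Real.sqrt (-(a * b)) * K) := by
        rw [show 1 + Real.exp 1 * l * B = 1 + l * B + (Real.exp 1 - 1) * (l * B) by ring, Real.exp_add (1 + l * B),
          Real.exp_add 1]
        ring

/-- **THE EDGE PRICE, LEFT SEGMENT (Markov's shape).**  Two probability spaces, observables `|X|, |Y| ≤ B` a.e.; if `|cgf_Y(t) − cgf_X(t)| ≤ ε`
for every real `a ≤ t ≤ 0` with `a < 0` (`0 ≤ ε`) — `0` an END of the segment — then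
`|∫ Y dν − ∫ X dμ| ≤ 32·e^{2+(2e−1)|a|B}·ε·(1 + log⁺ε⁻¹)²∕(|a|·log²(e + log⁺ε⁻¹))`
— module 1's cosine gauge and its second-order two-constants estimate. [folklore] -/
theorem abs_integral_sub_integral_le_edge_of_cgf_close_left (hX : AEMeasurable X μ) (hY : AEMeasurable Y ν)
    (hXB : ∀ᵐ ω ∂μ, |X ω| ≤ B) (hYB : ∀ᵐ ω ∂ν, |Y ω| ≤ B) {ε a : ℝ} (ha : a < 0) (hε0 : 0 ≤ ε)
    (hε : ∀ t : ℝ, a ≤ t → t ≤ 0 → |cgf Y ν t - cgf X μ t| ≤ ε) :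
    |∫ ω, Y ω ∂ν - ∫ ω, X ω ∂μ| ≤
      32 * Real.exp (2 + (2 * Real.exp 1 - 1) * |a| * B) * ε * (1 + Real.posLog ε⁻¹) ^ 2 /
        (|a| * Real.log (Real.exp 1 + Real.posLog ε⁻¹) ^ 2) := by
  have hB0 : 0 ≤ B := T4GenFunBounds.nonneg_of_ae_abs_le (IsProbabilityMeasure.ne_zero μ) hXB
  have hl0 : 0 < |a| := abs_pos.2 ha.ne
  set L := Real.posLog ε⁻¹ with hL
  have hL0 : 0 ≤ L := Real.posLog_nonneg
  have heL : 0 < Real.exp 1 + L := by positivity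
  set K := Real.log (Real.exp 1 + L) with hK
  have hK1 : 1 ≤ K := by rw [hK, Real.le_log_iff_exp_le heL]; linarith
  have hK0 : 0 < K := one_pos.trans_le hK1
  have hexpK : Real.exp K = Real.exp 1 + L := Real.exp_log heL
  have heK1 : 1 ≤ Real.exp K := Real.one_le_exp hK0.le
  set f : ℂ → ℂ := fun z => complexMGF Y ν z - complexMGF X μ z with hf
  have hdY := T4GenFunBounds.differentiable_complexMGF_of_abs_le hY hYB
  have hdX := T4GenFunBounds.differentiable_complexMGF_of_abs_le hX hXB
  have hfd : Differentiable ℂ f := hdY.sub hdX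
  have hrad : |a| / 2 * (1 + Real.exp (K * 1)) ≤ |a| * Real.exp K := by rw [mul_one]; nlinarith
  have hM : ∀ z : ℂ, ‖z‖ ≤ |a| / 2 * (1 + Real.exp (K * 1)) → ‖f z‖ ≤ 2 * Real.exp (|a| * Real.exp K * B) :=
    fun z hz => (norm_complexMGF_sub_complexMGF_le hXB hYB z).trans (by gcongr; exact hz.trans hrad)
  have hm : ∀ x : ℝ, a ≤ x → x ≤ 0 → ‖f x‖ ≤ 2 * ε * Real.exp (|a| * B) := fun x h1 h2 => by
    show ‖complexMGF Y ν x - complexMGF X μ x‖ ≤ _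
    rw [complexMGF_ofReal, complexMGF_ofReal, ← Complex.ofReal_sub, Complex.norm_real, Real.norm_eq_abs]
    have hxl : |x| ≤ |a| := by rw [abs_of_nonpos h2, abs_of_neg ha]; linarith
    exact (abs_mgf_sub_mgf_le_of_cgf_close hX hY hXB hYB (hε x h1 h2)).trans (by gcongr)
  have key := norm_deriv_le_sqlog_of_segment_end ha hK0 one_pos hfd hM hm (by positivity)
  have hderiv : deriv f 0 = (((∫ ω, Y ω ∂ν) - ∫ ω, X ω ∂μ : ℝ) : ℂ) := by
    have e1 : deriv f 0 = deriv (complexMGF Y ν) 0 - deriv (complexMGF X μ) 0 := deriv_sub (hdY 0) (hdX 0)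
    have eY := T4GenFunBounds.iteratedDeriv_complexMGF_zero_of_abs_le hY hYB 1
    have eX := T4GenFunBounds.iteratedDeriv_complexMGF_zero_of_abs_le hX hXB 1
    rw [iteratedDeriv_one] at eY eX
    rw [e1, eY, eX, Complex.ofReal_sub]
    simp
  rw [hderiv, Complex.norm_real, Real.norm_eq_abs, one_pow, one_mul] at key
  refine key.trans ?_
  rcases hε0.eq_or_lt with hε00 | hεpos
  · rw [← hε00]; simp
  -- `max(1, Λ/2) ≤ 1 + Λ ≤ 1 + |a|B(e^K − 1) + L ≤ e^{(e−1)|a|B}(1 + L)`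
  have hq : 2 * Real.exp (|a| * Real.exp K * B) / (2 * ε * Real.exp (|a| * B)) = Real.exp (|a| * B * (Real.exp K - 1)) * ε⁻¹ := by
    rw [show |a| * B * (Real.exp K - 1) = |a| * Real.exp K * B - |a| * B by ring, Real.exp_sub]
    field_simp
  have hb0 : 0 ≤ |a| * B := mul_nonneg hl0.le hB0
  have hc0 : 0 ≤ |a| * B * (Real.exp K - 1) := mul_nonneg hb0 (by linarith)
  have hlog : Real.posLog (2 * Real.exp (|a| * Real.exp K * B) / (2 * ε * Real.exp (|a| * B))) ≤ |a| * B * (Real.exp K - 1) + L := by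
    rw [hq]
    refine Real.posLog_mul.trans (add_le_add (le_of_eq ?_) le_rfl)
    rw [Real.posLog_eq_log (by rw [abs_of_pos (Real.exp_pos _)]; exact Real.one_le_exp hc0), Real.log_exp]
  have hnum : 1 + (|a| * B * (Real.exp K - 1) + L) ≤ Real.exp ((Real.exp 1 - 1) * (|a| * B)) * (1 + L) := by
    rw [hexpK]
    have h1 : 1 + (|a| * B * (Real.exp 1 + L - 1) + L) ≤ (1 + (Real.exp 1 - 1) * (|a| * B)) * (1 + L) := by
      nlinarith [mul_nonneg hb0 hL0, Real.add_one_le_exp (1 : ℝ)]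
    refine h1.trans (mul_le_mul_of_nonneg_right ?_ (by positivity))
    linarith [Real.add_one_le_exp ((Real.exp 1 - 1) * (|a| * B))]
  have hmax : max 1 (Real.posLog (2 * Real.exp (|a| * Real.exp K * B) / (2 * ε * Real.exp (|a| * B))) / 2) ≤
      Real.exp ((Real.exp 1 - 1) * (|a| * B)) * (1 + L) := by
    refine max_le ?_ ?_
    · calc (1 : ℝ) ≤ 1 + (|a| * B * (Real.exp K - 1) + L) := by linarith
        _ ≤ _ := hnum
    · calc Real.posLog (2 * Real.exp (|a| * Real.exp K * B) / (2 * ε * Real.exp (|a| * B))) / 2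
          ≤ Real.posLog (2 * Real.exp (|a| * Real.exp K * B) / (2 * ε * Real.exp (|a| * B))) :=
            div_le_self Real.posLog_nonneg (by norm_num)
        _ ≤ 1 + (|a| * B * (Real.exp K - 1) + L) := by linarith
        _ ≤ _ := hnum
  have e2 : Real.exp 2 = Real.exp 1 ^ 2 := by rw [Real.exp_one_pow, Nat.cast_ofNat]
  calc 16 * Real.exp 2 * (2 * ε * Real.exp (|a| * B)) *
        max 1 (Real.posLog (2 * Real.exp (|a| * Real.exp K * B) / (2 * ε * Real.exp (|a| * B))) / 2) ^ 2 / (|a| * K ^ 2)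
      ≤ 16 * Real.exp 2 * (2 * ε * Real.exp (|a| * B)) * (Real.exp ((Real.exp 1 - 1) * (|a| * B)) * (1 + L)) ^ 2 / (|a| * K ^ 2) := by
        gcongr
    _ = 32 * Real.exp (2 + (2 * Real.exp 1 - 1) * |a| * B) * ε * (1 + L) ^ 2 / (|a| * K ^ 2) := by
        rw [show 2 + (2 * Real.exp 1 - 1) * |a| * B = 2 + |a| * B + ((Real.exp 1 - 1) * (|a| * B) + (Real.exp 1 - 1) * (|a| * B)) by ring,
          Real.exp_add (2 + |a| * B), Real.exp_add 2, Real.exp_add ((Real.exp 1 - 1) * (|a| * B))]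
        ring

/-- **THE EDGE PRICE, RIGHT SEGMENT** (mirror of `_left` through `X ↦ −X`, `Y ↦ −Y`): cgf's `ε`-close on `0 ≤ t ≤ b`, `0 < b` ⇒
`|∫ Y dν − ∫ X dμ| ≤ 32·e^{2+(2e−1)bB}·ε·(1 + log⁺ε⁻¹)²∕(b·log²(e + log⁺ε⁻¹))`. [folklore] -/
theorem abs_integral_sub_integral_le_edge_of_cgf_close_right (hX : AEMeasurable X μ) (hY : AEMeasurable Y ν)
    (hXB : ∀ᵐ ω ∂μ, |X ω| ≤ B) (hYB : ∀ᵐ ω ∂ν, |Y ω| ≤ B) {ε b : ℝ} (hb : 0 < b) (hε0 : 0 ≤ ε)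
    (hε : ∀ t : ℝ, 0 ≤ t → t ≤ b → |cgf Y ν t - cgf X μ t| ≤ ε) :
    |∫ ω, Y ω ∂ν - ∫ ω, X ω ∂μ| ≤
      32 * Real.exp (2 + (2 * Real.exp 1 - 1) * b * B) * ε * (1 + Real.posLog ε⁻¹) ^ 2 /
        (b * Real.log (Real.exp 1 + Real.posLog ε⁻¹) ^ 2) := by
  have hXB' : ∀ᵐ ω ∂μ, |(-X) ω| ≤ B := hXB.mono fun ω h => by simpa using h
  have hYB' : ∀ᵐ ω ∂ν, |(-Y) ω| ≤ B := hYB.mono fun ω h => by simpa using h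
  have hε' : ∀ t : ℝ, -b ≤ t → t ≤ 0 → |cgf (-Y) ν t - cgf (-X) μ t| ≤ ε := fun t h1 h2 => by
    rw [cgf_neg, cgf_neg]
    exact hε (-t) (by linarith) (by linarith)
  have h := abs_integral_sub_integral_le_edge_of_cgf_close_left hX.neg hY.neg hXB' hYB' (neg_lt_zero.2 hb) hε0 hε'
  rw [abs_neg, abs_of_pos hb] at h
  have e : |∫ ω, (-Y) ω ∂ν - ∫ ω, (-X) ω ∂μ| = |∫ ω, Y ω ∂ν - ∫ ω, X ω ∂μ| := by
    simp only [Pi.neg_apply, integral_neg]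
    rw [← abs_neg]; ring_nf
  rwa [e] at h

end MGF

/-! ## §3 Tilted means of one class, two runs: Bernstein inside the window, Markov up to its edge -/

section Tilted

variable {Ω Ω' : Type*} {mΩ : MeasurableSpace Ω} {mΩ' : MeasurableSpace Ω'} {ν : Measure Ω} {ν' : Measure Ω'}
  [IsFiniteMeasure ν] [IsFiniteMeasure ν'] {F : Ω → ℝ} {F' : Ω' → ℝ} {B : ℝ}

/-- **CLOSE CGF's MOD A CONSTANT ON A WINDOW ⇒ CLOSE TILTED MEANS INSIDE, AT BERNSTEIN'S PRICE.**  `ν`, `ν′` non-zero finite, `F`, `F′`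
a.e.-measurable with `|F|, |F′| ≤ B` a.e.; if `|cgf F′ ν′ u − cgf F ν u − c| ≤ ε` for `|u| ≤ l₀` (ONE constant `c`, `0 ≤ ε`), then for every tilt
`|s| < l₀`:
`|tiltedMean F′ ν′ s − tiltedMean F ν s| ≤ 8e^{1+e(l₀+|s|)B}·ε·(1 + log⁺(2ε)⁻¹)∕(√(l₀² − s²)·log(e + log⁺(2ε)⁻¹))`
— §2's segment theorem for the tilted probability measures `e^{sF}ν∕∫e^{sF}dν`, `e^{sF′}ν′∕∫e^{sF′}dν′`, whose cgf's are the shifted ones (§1; the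
constant cancels) and are `2ε`-close on the WHOLE shifted window `[−l₀ − s, l₀ − s] ∋ 0` (`−ab = l₀² − s²`, `max(−a, b) = l₀ + |s|`).  Sharpens
p497552's `8e^{1+(l₀−l₁)B}·ε·(1 + log⁺(2ε)⁻¹)∕(l₀ − l₁)` (`|s| ≤ l₁ < l₀`) by `log log` and by the edge behaviour `1∕√(l₀² − s²)`. [folklore] -/
theorem abs_tiltedMean_sub_le_sharp_of_cgf_close [NeZero ν] [NeZero ν'] (hFm : AEMeasurable F ν) (hF : ∀ᵐ ω ∂ν, |F ω| ≤ B)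
    (hFm' : AEMeasurable F' ν') (hF' : ∀ᵐ ω ∂ν', |F' ω| ≤ B) {c ε l₀ s : ℝ} (hε0 : 0 ≤ ε)
    (hε : ∀ u : ℝ, |u| ≤ l₀ → |cgf F' ν' u - cgf F ν u - c| ≤ ε) (hs : |s| < l₀) :
    |tiltedMean F' ν' s - tiltedMean F ν s| ≤
      8 * Real.exp (1 + Real.exp 1 * (l₀ + |s|) * B) * ε * (1 + Real.posLog (2 * ε)⁻¹) /
        (Real.sqrt (l₀ ^ 2 - s ^ 2) * Real.log (Real.exp 1 + Real.posLog (2 * ε)⁻¹)) := by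
  haveI := isProbabilityMeasure_tilted_mul_of_ae (ν := ν) hFm hF s
  haveI := isProbabilityMeasure_tilted_mul_of_ae (ν := ν') hFm' hF' s
  obtain ⟨hs1, hs2⟩ := abs_lt.1 hs
  have ha : -l₀ - s < 0 := by linarith
  have hb : 0 < l₀ - s := by linarith
  have hclose : ∀ t : ℝ, -l₀ - s ≤ t → t ≤ l₀ - s →
      |cgf F' (ν'.tilted fun ω => s * F' ω) t - cgf F (ν.tilted fun ω => s * F ω) t| ≤ 2 * ε := by
    intro t h1 h2
    rw [cgf_tilted_mul_of_ae hFm' hF', cgf_tilted_mul_of_ae hFm hF]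
    have h3 := hε (s + t) (abs_le.2 ⟨by linarith, by linarith⟩)
    have h4 := hε s hs.le
    have e : cgf F' ν' (s + t) - cgf F' ν' s - (cgf F ν (s + t) - cgf F ν s)
        = (cgf F' ν' (s + t) - cgf F ν (s + t) - c) - (cgf F' ν' s - cgf F ν s - c) := by ring
    rw [e]
    exact (abs_sub _ _).trans (by linarith)
  have hac := tilted_absolutelyContinuous ν fun ω => s * F ω
  have hac' := tilted_absolutelyContinuous ν' fun ω => s * F' ω
  have key := abs_integral_sub_integral_le_sharp_of_cgf_close_segment (μ := ν.tilted fun ω => s * F ω)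
    (ν := ν'.tilted fun ω => s * F' ω) (X := F) (Y := F') (hFm.mono_ac hac) (hFm'.mono_ac hac') (hac.ae_le hF) (hac'.ae_le hF')
    ha hb (by positivity) hclose
  have e1 : max (-(-l₀ - s)) (l₀ - s) = l₀ + |s| := by
    rw [show -(-l₀ - s) = l₀ + s by ring, show l₀ - s = l₀ + -s by ring, max_add_add_left, ← abs_eq_max_neg]
  have e2 : -((-l₀ - s) * (l₀ - s)) = l₀ ^ 2 - s ^ 2 := by ring
  rw [e1, e2] at key
  calc |tiltedMean F' ν' s - tiltedMean F ν s|
      = |∫ ω, F' ω ∂(ν'.tilted fun ω => s * F' ω) - ∫ ω, F ω ∂(ν.tilted fun ω => s * F ω)| := rfl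
    _ ≤ _ := key
    _ = _ := by ring

/-- **… AND UP TO THE EDGE, AT MARKOV'S PRICE.**  Same hypotheses (`0 < l₀`); for every tilt `|s| ≤ l₀`, the edge `s = ±l₀` included:
`|tiltedMean F′ ν′ s − tiltedMean F ν s| ≤ 64e^{2+(2e−1)(l₀+|s|)B}·ε·(1 + log⁺(2ε)⁻¹)²∕(l₀·log²(e + log⁺(2ε)⁻¹))`
— the tilted cgf's are `2ε`-close on the half-window `[−l₀ − s, 0]` (if `s ≥ 0`) or `[0, l₀ − s]` (if `s < 0`), of length `l₀ + |s| ≥ l₀` with `0` at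
its END: §2's edge theorem.  Uniform on the CLOSED window; of Markov order `ε·n²`, `n = log ε⁻¹∕log log ε⁻¹` (attained at the edge: module 3). [folklore] -/
theorem abs_tiltedMean_sub_le_edge_of_cgf_close [NeZero ν] [NeZero ν'] (hFm : AEMeasurable F ν) (hF : ∀ᵐ ω ∂ν, |F ω| ≤ B)
    (hFm' : AEMeasurable F' ν') (hF' : ∀ᵐ ω ∂ν', |F' ω| ≤ B) {c ε l₀ s : ℝ} (hl₀ : 0 < l₀) (hε0 : 0 ≤ ε)
    (hε : ∀ u : ℝ, |u| ≤ l₀ → |cgf F' ν' u - cgf F ν u - c| ≤ ε) (hs : |s| ≤ l₀) :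
    |tiltedMean F' ν' s - tiltedMean F ν s| ≤
      64 * Real.exp (2 + (2 * Real.exp 1 - 1) * (l₀ + |s|) * B) * ε * (1 + Real.posLog (2 * ε)⁻¹) ^ 2 /
        (l₀ * Real.log (Real.exp 1 + Real.posLog (2 * ε)⁻¹) ^ 2) := by
  haveI := isProbabilityMeasure_tilted_mul_of_ae (ν := ν) hFm hF s
  haveI := isProbabilityMeasure_tilted_mul_of_ae (ν := ν') hFm' hF' s
  have hB0 : 0 ≤ B := T4GenFunBounds.nonneg_of_ae_abs_le (NeZero.ne ν) hF
  obtain ⟨hs1, hs2⟩ := abs_le.1 hs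
  -- the tilted cgf's are `2ε`-close at every `t` with `|s + t| ≤ l₀`
  have hclose : ∀ t : ℝ, |s + t| ≤ l₀ →
      |cgf F' (ν'.tilted fun ω => s * F' ω) t - cgf F (ν.tilted fun ω => s * F ω) t| ≤ 2 * ε := by
    intro t ht
    rw [cgf_tilted_mul_of_ae hFm' hF', cgf_tilted_mul_of_ae hFm hF]
    have h3 := hε (s + t) ht
    have h4 := hε s hs
    have e : cgf F' ν' (s + t) - cgf F' ν' s - (cgf F ν (s + t) - cgf F ν s)
        = (cgf F' ν' (s + t) - cgf F ν (s + t) - c) - (cgf F' ν' s - cgf F ν s - c) := by ring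
    rw [e]
    exact (abs_sub _ _).trans (by linarith)
  have hac := tilted_absolutelyContinuous ν fun ω => s * F ω
  have hac' := tilted_absolutelyContinuous ν' fun ω => s * F' ω
  have hlen : l₀ ≤ l₀ + |s| := le_add_of_nonneg_right (abs_nonneg s)
  have hpos : 0 < l₀ + |s| := hl₀.trans_le hlen
  set L := Real.posLog (2 * ε)⁻¹ with hL
  have hlogpos : 0 < Real.log (Real.exp 1 + L) :=
    Real.log_pos (by linarith [Real.add_one_le_exp (1 : ℝ), Real.posLog_nonneg (x := (2 * ε)⁻¹)])
  have hmono : 32 * Real.exp (2 + (2 * Real.exp 1 - 1) * (l₀ + |s|) * B) * (2 * ε) * (1 + L) ^ 2 /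
      ((l₀ + |s|) * Real.log (Real.exp 1 + L) ^ 2) ≤
      64 * Real.exp (2 + (2 * Real.exp 1 - 1) * (l₀ + |s|) * B) * ε * (1 + L) ^ 2 / (l₀ * Real.log (Real.exp 1 + L) ^ 2) := by
    rw [show 32 * Real.exp (2 + (2 * Real.exp 1 - 1) * (l₀ + |s|) * B) * (2 * ε) =
      64 * Real.exp (2 + (2 * Real.exp 1 - 1) * (l₀ + |s|) * B) * ε by ring]
    gcongr
  have etm : tiltedMean F' ν' s - tiltedMean F ν s =
      ∫ ω, F' ω ∂(ν'.tilted fun ω => s * F' ω) - ∫ ω, F ω ∂(ν.tilted fun ω => s * F ω) := rfl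
  rw [etm]
  rcases le_or_gt 0 s with hs0 | hs0
  · -- `s ≥ 0`: the left half-window `[−l₀ − s, 0]`
    have ha : -l₀ - s < 0 := by linarith
    have h := abs_integral_sub_integral_le_edge_of_cgf_close_left (μ := ν.tilted fun ω => s * F ω)
      (ν := ν'.tilted fun ω => s * F' ω) (X := F) (Y := F') (hFm.mono_ac hac) (hFm'.mono_ac hac') (hac.ae_le hF)
      (hac'.ae_le hF') ha (by positivity : (0 : ℝ) ≤ 2 * ε)
      (fun t h1 h2 => hclose t (abs_le.2 ⟨by linarith, by linarith⟩))
    rw [show |(-l₀ - s)| = l₀ + |s| by rw [abs_of_neg ha, abs_of_nonneg hs0]; ring] at h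
    exact h.trans hmono
  · -- `s < 0`: the right half-window `[0, l₀ − s]`
    have hb : 0 < l₀ - s := by linarith
    have h := abs_integral_sub_integral_le_edge_of_cgf_close_right (μ := ν.tilted fun ω => s * F ω)
      (ν := ν'.tilted fun ω => s * F' ω) (X := F) (Y := F') (hFm.mono_ac hac) (hFm'.mono_ac hac') (hac.ae_le hF)
      (hac'.ae_le hF') hb (by positivity : (0 : ℝ) ≤ 2 * ε)
      (fun t h1 h2 => hclose t (abs_le.2 ⟨by linarith, by linarith⟩))
    rw [show l₀ - s = l₀ + |s| by rw [abs_of_neg hs0]; ring] at h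
    exact h.trans hmono

end Tilted

end Summit.QuantumFields.YangMills.Theorems.BalabanUVNodesN19TiltedPrice

end
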